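import Mathlib
import HarnessLib
import Literature.Analysis.FluidPDE.SpaceTimeCalculus
import Summits.NavierStokesRegularity.NavierStokesRegularity.Theorems.PoloidalWindowDoorLrcModEntireTwistingTHFlatRidgeJet

/-!
# Item `LrcModEntire` (stmt-NavierStokesRegularity-20428) — THE SPACE–TIME HESSIAN PIN AT A HOT POINT and THE MIXED PIN `∇(∂ₜv₂)(−1,y) = 0` OF THE FLAT SUB-CELL

ns-k2-port-2 g7, helper of item 20428 under LEAD ns-poloidal-K2-p3 g15 (`--supports stmt-NavierStokesRegularity-20428 --as helper`).
Memo `Cruxes/LrcModEntire/T2B-g15.md` §16b («one more pin holds in the flat cell and is not yet typed»): at a hot point `y` of a class profile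
(`v₂(−1,y) = v₂(−1,0) = N ≠ 0`, `√(−t)|v₂| ≤ |N|` on the whole past, `σN = |N|`) the WEIGHTED SIGNED COMPONENT
`G(t,x) := √(−t)·σ·v₂(t,x)` has a space–time maximum at `(−1,y)`, so its joint second derivative there is a NEGATIVE SEMI-DEFINITE symmetric form on
`ℝ × ℝ³`.  Consequences typed here:

* `spacetimeHessian_weighted_nonpos_of_hotPoint` — `D²(uncurry G)(−1,y)[d,d] ≤ 0` for every space–time direction `d`;
* `timeTimePin_of_hotPoint` — the `(t,t)` entry: **`σ·∂ₜ²v₂(−1,y) ≤ 3|N|/4`** at every hot point (with `∂ₜv₂ = N/2` there);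
* `fderiv_timeDeriv_two_eq_zero_of_hessian_null` / `deriv_fderiv_two_eq_zero_of_hessian_null` — the MIXED PIN from a null direction: if the slice
  Hessian `D²(σv₂(−1,·))(y)` vanishes on `(w,w)`, then `∂_w(∂ₜv₂)(−1,·)(y) = 0 = ∂ₜ(∂_w v₂)(−1,y)` (a negative semi-definite form vanishing on `(e,e)` has
  `e` in its kernel, `…FlatRidgeJet.bilin_apply_eq_zero_of_nonpos` on `ℝ × ℝ³`; the `(x,x)` block of `D²(uncurry G)(−1,y)` IS the slice Hessian);
* `fderiv_timeDeriv_two_eq_zero_of_flatHotPoint` — the flat corollary (hypotheses of `…FlatRidgeJet.hessian_eq_zero_of_flatHotPoint` VERBATIM):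
  **`∇ₓ(∂ₜv₂)(−1,·)(y) = 0` at every flat hot point.**

Tools (class-free): `deriv2_nonpos_of_isLocalMax_of_continuousAt` (1-D second-derivative necessity from CONTINUITY only, via Mathlib's
`isLocalMin_of_deriv_deriv_pos`), `deriv2_line_eq_fderiv_fderiv` (local line formula), and the second-order space–time dictionary entries
`fderiv_fderiv_slice_apply` (`(x,x)` block) / `deriv_deriv_timeLine` (`(t,t)` entry) complementing `Literature…SpaceTimeCalculus`.

WHAT THIS IS NOT: not a claim about Navier–Stokes regularity and not a proof of `stub_T2b` / `stub_T2bFlat`; point identities for the OPEN flat sub-cell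
(bears_on LADDER-NS N0, item 20428 / crux 19708; OPEN).
-/

set_option linter.style.longLine false
set_option linter.dupNamespace false

namespace Summit.NavierStokesRegularity.NavierStokesRegularity.Theorems.PoloidalWindowDoorLrcModEntireTwistingTHFlatRidgeMixedPin

open Set Function Filter Topology Metric
open scoped RealInnerProductSpace InnerProductSpace ContDiff
open Literature.Analysis Literature.Analysis.FluidPDE Literature.Analysis.UnboundedOperators
open Summit.NavierStokesRegularity.NavierStokesRegularity.Theorems
open Summit.NavierStokesRegularity.NavierStokesRegularity.Theorems.LocalSineTubeDoorProfileAlignedWindowRigidityAncient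
open Summit.NavierStokesRegularity.NavierStokesRegularity.Theorems.PoloidalWindowDoorLrcModEntireRidgeWiring
open Summit.NavierStokesRegularity.NavierStokesRegularity.Theorems.PoloidalWindowDoorLrcModEntireThreadPins
open Summit.NavierStokesRegularity.NavierStokesRegularity.Theorems.PoloidalWindowDoorLrcModEntireTwistingTHFlatRidgeJet

/-! ### Class-free tools -/

/-- 1-D necessity half of the second-derivative test from CONTINUITY only: a function continuous at `a` with a local maximum at `a` has
`(deriv (deriv φ)) a ≤ 0` (if it were positive, Mathlib's `isLocalMin_of_deriv_deriv_pos` would make `a` also a local minimum, so `φ` is locally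
constant and the second derivative vanishes). -/
theorem deriv2_nonpos_of_isLocalMax_of_continuousAt {φ : ℝ → ℝ} {a : ℝ} (hc : ContinuousAt φ a) (hmax : IsLocalMax φ a) :
    deriv (deriv φ) a ≤ 0 := by
  by_contra hpos
  push Not at hpos
  have hmin : IsLocalMin φ a := isLocalMin_of_deriv_deriv_pos hpos hmax.deriv_eq_zero hc
  have heq : ∀ᶠ x in 𝓝 a, φ x = φ a := by
    filter_upwards [hmax, hmin] with x h1 h2 using le_antisymm h1 h2
  have hd : ∀ᶠ x in 𝓝 a, deriv φ x = 0 := by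
    filter_upwards [heq.eventually_nhds] with x hx
    have h : φ =ᶠ[𝓝 x] fun _ => φ a := hx
    rw [h.deriv_eq, deriv_const]
  have h2 : deriv φ =ᶠ[𝓝 a] fun _ => (0 : ℝ) := hd
  have h0 : deriv (deriv φ) a = 0 := by rw [h2.deriv_eq, deriv_const]
  exact absurd h0 (ne_of_gt hpos)

/-- Local line formula: for `F` of class `C²` AT `p`, the second derivative of `s ↦ F(p + s•d)` at `0` is `D²F(p)[d][d]`. -/
theorem deriv2_line_eq_fderiv_fderiv {E : Type*} [NormedAddCommGroup E] [NormedSpace ℝ E] {F : E → ℝ} {p : E}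
    (hF : ContDiffAt ℝ 2 F p) (d : E) :
    deriv (deriv (fun s : ℝ => F (p + s • d))) 0 = fderiv ℝ (fderiv ℝ F) p d d := by
  have hline : ∀ s : ℝ, HasDerivAt (fun s : ℝ => p + s • d) d s := fun s => by
    simpa using ((hasDerivAt_id s).smul_const d).const_add p
  have h0 : p + (0 : ℝ) • d = p := by simp
  have hev : ∀ᶠ q in 𝓝 p, DifferentiableAt ℝ F q := by
    filter_upwards [hF.eventually (by simp)] with q hq using hq.differentiableAt (by simp)
  have ht : Tendsto (fun s : ℝ => p + s • d) (𝓝 0) (𝓝 p) := by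
    have h := (hline 0).continuousAt.tendsto
    rwa [h0] at h
  have h1 : deriv (fun s : ℝ => F (p + s • d)) =ᶠ[𝓝 0] fun s => fderiv ℝ F (p + s • d) d := by
    filter_upwards [ht.eventually hev] with s hs using (hs.hasFDerivAt.comp_hasDerivAt s (hline s)).deriv
  rw [h1.deriv_eq]
  have hd2 : DifferentiableAt ℝ (fderiv ℝ F) (p + (0 : ℝ) • d) := by
    rw [h0]; exact (hF.fderiv_right (m := 1) (by norm_num)).differentiableAt (by simp)
  have hc : HasDerivAt (fun s : ℝ => fderiv ℝ F (p + s • d)) (fderiv ℝ (fderiv ℝ F) (p + (0 : ℝ) • d) d) 0 :=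
    hd2.hasFDerivAt.comp_hasDerivAt (0 : ℝ) (hline 0)
  have h2 := hc.clm_apply (hasDerivAt_const (0 : ℝ) d)
  rw [h2.deriv]
  simp

section Dictionary

variable {X : Type*} [NormedAddCommGroup X] [NormedSpace ℝ X]
variable {F : Type*} [NormedAddCommGroup F] [NormedSpace ℝ F]
variable {S : Set ℝ} {w : ℝ → X → F} {t : ℝ}

/-- Second-order space–time dictionary, spatial–spatial block: on an open time set,
`D(D(w t)(·) a)(x) b = D²(uncurry w)(t, x) (0, b) (0, a)` (companion of `IsSmoothSpaceTimeOn.deriv_fderiv_slice_apply`). -/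
theorem fderiv_fderiv_slice_apply (h : IsSmoothSpaceTimeOn S w) (hS : IsOpen S) (ht : t ∈ S) (x a b : X) :
    fderiv ℝ (fun y => fderiv ℝ (w t) y a) x b = fderiv ℝ (fderiv ℝ (uncurry w)) (t, x) (0, b) (0, a) := by
  have hU : IsOpen (S ×ˢ (univ : Set X)) := hS.prod isOpen_univ
  have h1 := (h.isSmoothSpaceTimeOn_fderiv_apply hS a).fderiv_slice_apply_of_isOpen hS ht x b
  change fderiv ℝ (fun y => fderiv ℝ (w t) y a) x b = _ at h1
  rw [h1]
  have heq : uncurry (fun t x => fderiv ℝ (w t) x a) =ᶠ[𝓝 (t, x)] fun z => fderiv ℝ (uncurry w) z (0, a) := by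
    filter_upwards [hU.mem_nhds (mk_mem_prod ht (mem_univ x))] with z hz
    exact h.fderiv_slice_apply_of_isOpen hS hz.1 z.2 a
  rw [heq.fderiv_eq, fderiv_clm_apply (h.differentiableAt_fderiv_uncurry hS ht x) (differentiableAt_const _)]
  simp

/-- Second-order space–time dictionary, time–time entry: on an open time set,
`∂ₜ²(w(·, x))(t) = D²(uncurry w)(t, x) (1, 0) (1, 0)`. -/
theorem deriv_deriv_timeLine (h : IsSmoothSpaceTimeOn S w) (hS : IsOpen S) (ht : t ∈ S) (x : X) :
    deriv (deriv (fun s => w s x)) t = fderiv ℝ (fderiv ℝ (uncurry w)) (t, x) (1, 0) (1, 0) := by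
  have hU : IsOpen (S ×ˢ (univ : Set X)) := hS.prod isOpen_univ
  have h1 := (h.isSmoothSpaceTimeOn_deriv hS).deriv_timeLine hS ht x
  change deriv (fun s => deriv (fun s' => w s' x) s) t = _ at h1
  change deriv (fun s => deriv (fun s' => w s' x) s) t = _
  rw [h1]
  have heq : uncurry (fun t x => deriv (fun s => w s x) t) =ᶠ[𝓝 (t, x)] fun z => fderiv ℝ (uncurry w) z (1, 0) := by
    filter_upwards [hU.mem_nhds (mk_mem_prod ht (mem_univ x))] with z hz
    exact h.deriv_timeLine hS hz.1 z.2
  rw [heq.fderiv_eq, fderiv_clm_apply (h.differentiableAt_fderiv_uncurry hS ht x) (differentiableAt_const _)]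
  simp

end Dictionary

/-! ### The weighted signed component `G(t,x) = √(−t)·σ·v₂(t,x)` of a class profile -/

variable {C : ℝ} {v : ℝ → EuclideanSpace ℝ (Fin 3) → EuclideanSpace ℝ (Fin 3)}

/-- The vertical component `(t,x) ↦ v₂(t,x)` of a class profile is jointly smooth on the open past `t < 0` (joint real-analyticity, `analyticOnNhd_uncurry`). -/
theorem isSmoothSpaceTimeOn_two (hrate : HasTypeITimeDecay C v) (hcont : ContinuousOn (uncurry v) (Iio (0 : ℝ) ×ˢ univ))
    (hmild : ∀ s t : ℝ, s < t → t < 0 → ∀ x, v t x = heatExtension (v s) (t - s) x - oseenDuhamel 1 s v v t x) :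
    IsSmoothSpaceTimeOn (Iio 0) (fun t x => v t x 2) := by
  have h : ContDiffOn ℝ ∞ (uncurry v) (Iio (0 : ℝ) ×ˢ univ) :=
    (analyticOnNhd_uncurry hcont (bdd_of_hasTypeITimeDecay hrate) hmild).contDiffOn_of_completeSpace
  have h2 : ContDiffOn ℝ ∞ ((EuclideanSpace.proj (𝕜 := ℝ) (2 : Fin 3)) ∘ uncurry v) (Iio (0 : ℝ) ×ˢ univ) :=
    (EuclideanSpace.proj (𝕜 := ℝ) (2 : Fin 3)).contDiff.comp_contDiffOn h
  exact h2

/-- The weighted signed component `(t,x) ↦ √(−t)·σ·v₂(t,x)` is jointly smooth on the open past `t < 0`. -/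
theorem isSmoothSpaceTimeOn_weighted (hrate : HasTypeITimeDecay C v) (hcont : ContinuousOn (uncurry v) (Iio (0 : ℝ) ×ˢ univ))
    (hmild : ∀ s t : ℝ, s < t → t < 0 → ∀ x, v t x = heatExtension (v s) (t - s) x - oseenDuhamel 1 s v v t x) (σ : ℝ) :
    IsSmoothSpaceTimeOn (Iio 0) (fun t x => Real.sqrt (-t) * (σ * v t x 2)) := by
  have hθ : ContDiffOn ℝ ∞ (fun z : ℝ × EuclideanSpace ℝ (Fin 3) => v z.1 z.2 2) (Iio (0 : ℝ) ×ˢ univ) :=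
    isSmoothSpaceTimeOn_two hrate hcont hmild
  have hs : ContDiffOn ℝ ∞ (fun z : ℝ × EuclideanSpace ℝ (Fin 3) => Real.sqrt (-z.1)) (Iio (0 : ℝ) ×ˢ univ) := by
    intro z hz
    have hz1 : -z.1 ≠ 0 := (neg_pos.2 (mem_prod.1 hz).1).ne'
    have h1 : ContDiffAt ℝ ∞ (fun z : ℝ × EuclideanSpace ℝ (Fin 3) => -z.1) z := contDiffAt_fst.neg
    exact ((Real.contDiffAt_sqrt hz1).comp z h1).contDiffWithinAt
  show ContDiffOn ℝ ∞ (fun z : ℝ × EuclideanSpace ℝ (Fin 3) => Real.sqrt (-z.1) * (σ * v z.1 z.2 2)) (Iio (0 : ℝ) ×ˢ univ)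
  exact hs.mul (contDiffOn_const.mul hθ)

/-- `|σ| = 1` from the sign normalisation `σN = |N|`, `N ≠ 0`. -/
theorem abs_sigma_eq_one (hne : v (-1) 0 2 ≠ 0) {σ : ℝ} (hσN : σ * v (-1) 0 2 = |v (-1) 0 2|) : |σ| = 1 := by
  have h := congrArg abs hσN
  rw [abs_mul, abs_abs] at h
  have hN : 0 < |v (-1) 0 2| := abs_pos.2 hne
  nlinarith

/-- **The weighted signed component has a space–time maximum at every hot point:** `√(−t)·σ·v₂(t,x) ≤ σ·v₂(−1,y) = |N|` for all `t < 0`, hence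
`IsLocalMax (uncurry G) (−1,y)`. -/
theorem isLocalMax_weighted_of_hotPoint (hne : v (-1) 0 2 ≠ 0) (hhot : ∀ t < 0, ∀ x, Real.sqrt (-t) * |v t x 2| ≤ |v (-1) 0 2|)
    {σ : ℝ} (hσN : σ * v (-1) 0 2 = |v (-1) 0 2|) {y : EuclideanSpace ℝ (Fin 3)} (hy : v (-1) y 2 = v (-1) 0 2) :
    IsLocalMax (uncurry fun t x => Real.sqrt (-t) * (σ * v t x 2)) ((-1 : ℝ), y) := by
  have hσ1 := abs_sigma_eq_one hne hσN
  have hσle : ∀ a : ℝ, σ * a ≤ |a| := fun a =>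
    calc σ * a ≤ |σ * a| := le_abs_self _
      _ = |a| := by rw [abs_mul, hσ1, one_mul]
  have hU : {z : ℝ × EuclideanSpace ℝ (Fin 3) | z.1 < 0} ∈ 𝓝 (((-1 : ℝ), y) : ℝ × EuclideanSpace ℝ (Fin 3)) :=
    (isOpen_lt continuous_fst continuous_const).mem_nhds (by show (-1 : ℝ) < 0; norm_num)
  filter_upwards [hU] with z hz
  show Real.sqrt (-z.1) * (σ * v z.1 z.2 2) ≤ Real.sqrt (-(-1 : ℝ)) * (σ * v (-1) y 2)
  rw [neg_neg, Real.sqrt_one, one_mul, hy, hσN]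
  calc Real.sqrt (-z.1) * (σ * v z.1 z.2 2) ≤ Real.sqrt (-z.1) * |v z.1 z.2 2| :=
        mul_le_mul_of_nonneg_left (hσle _) (Real.sqrt_nonneg _)
    _ ≤ |v (-1) 0 2| := hhot z.1 hz z.2

/-- **SPACE–TIME HESSIAN PIN at every hot point:** `D²(uncurry G)(−1,y)[d][d] ≤ 0` for every space–time direction `d ∈ ℝ × ℝ³`, `G(t,x) = √(−t)·σ·v₂(t,x)`. -/
theorem spacetimeHessian_weighted_nonpos_of_hotPoint (hrate : HasTypeITimeDecay C v) (hcont : ContinuousOn (uncurry v) (Iio (0 : ℝ) ×ˢ univ))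
    (hmild : ∀ s t : ℝ, s < t → t < 0 → ∀ x, v t x = heatExtension (v s) (t - s) x - oseenDuhamel 1 s v v t x)
    (hne : v (-1) 0 2 ≠ 0) (hhot : ∀ t < 0, ∀ x, Real.sqrt (-t) * |v t x 2| ≤ |v (-1) 0 2|)
    {σ : ℝ} (hσN : σ * v (-1) 0 2 = |v (-1) 0 2|) {y : EuclideanSpace ℝ (Fin 3)} (hy : v (-1) y 2 = v (-1) 0 2)
    (d : ℝ × EuclideanSpace ℝ (Fin 3)) :
    fderiv ℝ (fderiv ℝ (uncurry fun t x => Real.sqrt (-t) * (σ * v t x 2))) ((-1 : ℝ), y) d d ≤ 0 := by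
  have h1 : (-1 : ℝ) ∈ Iio (0 : ℝ) := by norm_num
  have hG := isSmoothSpaceTimeOn_weighted hrate hcont hmild σ
  have hmax := isLocalMax_weighted_of_hotPoint hne hhot hσN hy
  set G : ℝ → EuclideanSpace ℝ (Fin 3) → ℝ := fun t x => Real.sqrt (-t) * (σ * v t x 2) with hGdef
  set z₀ : ℝ × EuclideanSpace ℝ (Fin 3) := ((-1 : ℝ), y) with hz₀
  have hC : ContDiffAt ℝ 2 (uncurry G) z₀ := (hG.contDiffAt isOpen_Iio h1 y).of_le (by exact WithTop.coe_le_coe.2 le_top)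
  have hlin : Continuous (fun s : ℝ => z₀ + s • d) := continuous_const.add (continuous_id.smul continuous_const)
  have e0 : z₀ + (0 : ℝ) • d = z₀ := by simp
  have hφmax : IsLocalMax (fun s : ℝ => uncurry G (z₀ + s • d)) 0 := by
    have h : IsLocalMax (uncurry G) ((fun s : ℝ => z₀ + s • d) 0) := by simp only [zero_smul, add_zero]; exact hmax
    exact IsLocalMax.comp_continuous (g := fun s : ℝ => z₀ + s • d) (b := 0) h hlin.continuousAt
  have hφc : ContinuousAt (fun s : ℝ => uncurry G (z₀ + s • d)) 0 :=
    ContinuousAt.comp_of_eq hC.continuousAt hlin.continuousAt e0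
  have h := deriv2_nonpos_of_isLocalMax_of_continuousAt hφc hφmax
  rwa [deriv2_line_eq_fderiv_fderiv hC d] at h

/-- The time derivative of `G(·,x) = √(−·)·σ·v₂(·,x)` at `t = −1`: `∂ₜG(−1,x) = σ·∂ₜv₂(−1,x) − σ·v₂(−1,x)/2`, for EVERY `x`. -/
theorem hasDerivAt_weighted_timeLine (hrate : HasTypeITimeDecay C v) (hcont : ContinuousOn (uncurry v) (Iio (0 : ℝ) ×ˢ univ))
    (hmild : ∀ s t : ℝ, s < t → t < 0 → ∀ x, v t x = heatExtension (v s) (t - s) x - oseenDuhamel 1 s v v t x) (σ : ℝ)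
    (x : EuclideanSpace ℝ (Fin 3)) :
    HasDerivAt (fun s => Real.sqrt (-s) * (σ * v s x 2)) (σ * deriv (fun s => v s x 2) (-1) - (1 / 2 : ℝ) * (σ * v (-1) x 2)) (-1) := by
  have h1 : (-1 : ℝ) ∈ Iio (0 : ℝ) := by norm_num
  have hθ := isSmoothSpaceTimeOn_two hrate hcont hmild
  have hsqrt : HasDerivAt (fun s : ℝ => Real.sqrt (-s)) (1 / (2 * Real.sqrt (-(-1 : ℝ))) * (-1)) (-1) :=
    (Real.hasDerivAt_sqrt (by norm_num)).comp (-1) (hasDerivAt_neg (-1 : ℝ))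
  have hk : HasDerivAt (fun s => σ * v s x 2) (σ * deriv (fun s => v s x 2) (-1)) (-1) := by
    have h := hθ.hasDerivAt_timeLine isOpen_Iio h1 x
    exact h.const_mul σ
  have h := hsqrt.mul hk
  refine h.congr_deriv ?_
  rw [neg_neg, Real.sqrt_one]
  ring

/-- **TIME–TIME PIN at every hot point:** `σ·∂ₜ²v₂(−1,y) ≤ 3|N|/4` (the `(t,t)` entry of the space–time Hessian pin; `∂ₜv₂(−1,y) = N/2` is the first-order
condition in `t`).  In the flat cell this is the `3N/4 − θ_tt ≥ 0` of memo T2B-g15 §17d. -/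
theorem timeTimePin_of_hotPoint (hrate : HasTypeITimeDecay C v) (hcont : ContinuousOn (uncurry v) (Iio (0 : ℝ) ×ˢ univ))
    (hmild : ∀ s t : ℝ, s < t → t < 0 → ∀ x, v t x = heatExtension (v s) (t - s) x - oseenDuhamel 1 s v v t x)
    (hne : v (-1) 0 2 ≠ 0) (hhot : ∀ t < 0, ∀ x, Real.sqrt (-t) * |v t x 2| ≤ |v (-1) 0 2|)
    {σ : ℝ} (hσN : σ * v (-1) 0 2 = |v (-1) 0 2|) {y : EuclideanSpace ℝ (Fin 3)} (hy : v (-1) y 2 = v (-1) 0 2) :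
    σ * deriv (deriv (fun s => v s y 2)) (-1) ≤ 3 * |v (-1) 0 2| / 4 := by
  have h1 : (-1 : ℝ) ∈ Iio (0 : ℝ) := by norm_num
  have hθ := isSmoothSpaceTimeOn_two hrate hcont hmild
  have hG := isSmoothSpaceTimeOn_weighted hrate hcont hmild σ
  have hmax := isLocalMax_weighted_of_hotPoint hne hhot hσN hy
  set G : ℝ → EuclideanSpace ℝ (Fin 3) → ℝ := fun t x => Real.sqrt (-t) * (σ * v t x 2) with hGdef
  -- the `(t,t)` entry of the space–time Hessian is `≤ 0` and equals `∂ₜ²G(−1,y)`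
  have hneg := spacetimeHessian_weighted_nonpos_of_hotPoint hrate hcont hmild hne hhot hσN hy ((1 : ℝ), (0 : EuclideanSpace ℝ (Fin 3)))
  rw [← deriv_deriv_timeLine hG isOpen_Iio h1 y] at hneg
  change deriv (deriv (fun s => G s y)) (-1) ≤ 0 at hneg
  -- first order in `t`: `∂ₜG(−1,y) = 0`, i.e. `σ∂ₜv₂(−1,y) = σN/2`
  have hfd0 : fderiv ℝ (uncurry G) ((-1 : ℝ), y) = 0 := hmax.fderiv_eq_zero
  have ht1 : deriv (fun s => G s y) (-1) = 0 := by
    rw [hG.deriv_timeLine isOpen_Iio h1 y, hfd0]; simp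
  have hline : ∀ x : EuclideanSpace ℝ (Fin 3), deriv (fun s => G s x) (-1) = σ * deriv (fun s => v s x 2) (-1) - (1 / 2 : ℝ) * (σ * v (-1) x 2) :=
    fun x => (hasDerivAt_weighted_timeLine hrate hcont hmild σ x).deriv
  have hpin1 : σ * deriv (fun s => v s y 2) (-1) = |v (-1) 0 2| / 2 := by
    have h := hline y
    rw [ht1, hy, hσN] at h
    linarith
  -- second order in `t`: differentiate `∂ₜG(s,y) = a′(s)k(s) + a(s)k′(s)` once more at `s = −1`
  have hU : ∀ᶠ s in 𝓝 (-1 : ℝ), s < 0 := Iio_mem_nhds (by norm_num)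
  have hθt := hθ.isSmoothSpaceTimeOn_deriv isOpen_Iio
  have hder : deriv (fun s => G s y) =ᶠ[𝓝 (-1 : ℝ)]
      fun s => (-(1 / 2 : ℝ) * (Real.sqrt (-s))⁻¹) * (σ * v s y 2) + Real.sqrt (-s) * (σ * deriv (fun s' => v s' y 2) s) := by
    filter_upwards [hU] with s hs
    have hs0 : -s ≠ 0 := (neg_pos.2 hs).ne'
    have ha : HasDerivAt (fun s : ℝ => Real.sqrt (-s)) (1 / (2 * Real.sqrt (-s)) * (-1)) s :=
      (Real.hasDerivAt_sqrt hs0).comp s (hasDerivAt_neg s)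
    have ha' : HasDerivAt (fun s : ℝ => Real.sqrt (-s)) (-(1 / 2 : ℝ) * (Real.sqrt (-s))⁻¹) s :=
      ha.congr_deriv (by rw [one_div, mul_inv]; ring)
    have hk : HasDerivAt (fun s' => σ * v s' y 2) (σ * deriv (fun s' => v s' y 2) s) s :=
      (hθ.hasDerivAt_timeLine isOpen_Iio hs y).const_mul σ
    exact (ha'.fun_mul hk).deriv
  rw [hder.deriv_eq] at hneg
  -- derivatives of the four factors at `s = −1`
  have ha1 : HasDerivAt (fun s : ℝ => Real.sqrt (-s)) (-(1 / 2 : ℝ)) (-1) := by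
    have h := (Real.hasDerivAt_sqrt (by norm_num : -(-1 : ℝ) ≠ 0)).comp (-1) (hasDerivAt_neg (-1 : ℝ))
    refine h.congr_deriv ?_
    rw [neg_neg, Real.sqrt_one]; ring
  have ha2 : HasDerivAt (fun s : ℝ => -(1 / 2 : ℝ) * (Real.sqrt (-s))⁻¹) (-(1 / 2 : ℝ) * (1 / 2)) (-1) := by
    have hinv := ha1.inv (by rw [neg_neg, Real.sqrt_one]; norm_num)
    have h := hinv.const_mul (-(1 / 2 : ℝ))
    refine h.congr_deriv ?_
    norm_num [Real.sqrt_one]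
  have hk1 : HasDerivAt (fun s' => σ * v s' y 2) (σ * deriv (fun s' => v s' y 2) (-1)) (-1) :=
    (hθ.hasDerivAt_timeLine isOpen_Iio h1 y).const_mul σ
  have hk2 : HasDerivAt (fun s => σ * deriv (fun s' => v s' y 2) s) (σ * deriv (deriv (fun s' => v s' y 2)) (-1)) (-1) := by
    have h := hθt.hasDerivAt_timeLine isOpen_Iio h1 y
    change HasDerivAt (fun s => deriv (fun s' => v s' y 2) s) (deriv (fun s => deriv (fun s' => v s' y 2) s) (-1)) (-1) at h
    exact h.const_mul σ
  have htot := (ha2.fun_mul hk1).fun_add (ha1.fun_mul hk2)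
  rw [htot.deriv] at hneg
  simp only [neg_neg, Real.sqrt_one, inv_one, hy] at hneg
  have hσabs := abs_sigma_eq_one hne hσN
  nlinarith [hneg, hpin1, hσN, abs_nonneg (v (-1) 0 2)]

/-- **MIXED PIN FROM A NULL DIRECTION (form `∇(∂ₜv₂)`):** at a hot point `y`, if the slice Hessian `D²(σv₂(−1,·))(y)` vanishes on `(w,w)` then
`D(∂ₜv₂(−1,·))(y) w = 0`. -/
theorem fderiv_timeDeriv_two_eq_zero_of_hessian_null (hrate : HasTypeITimeDecay C v) (hcont : ContinuousOn (uncurry v) (Iio (0 : ℝ) ×ˢ univ))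
    (hmild : ∀ s t : ℝ, s < t → t < 0 → ∀ x, v t x = heatExtension (v s) (t - s) x - oseenDuhamel 1 s v v t x)
    (hne : v (-1) 0 2 ≠ 0) (hhot : ∀ t < 0, ∀ x, Real.sqrt (-t) * |v t x 2| ≤ |v (-1) 0 2|)
    {σ : ℝ} (hσN : σ * v (-1) 0 2 = |v (-1) 0 2|) {y : EuclideanSpace ℝ (Fin 3)} (hy : v (-1) y 2 = v (-1) 0 2)
    {w : EuclideanSpace ℝ (Fin 3)} (hnull : fderiv ℝ (fderiv ℝ (fun x => σ * v (-1) x 2)) y w w = 0) :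
    fderiv ℝ (fun x => deriv (fun s => v s x 2) (-1)) y w = 0 := by
  have h1 : (-1 : ℝ) ∈ Iio (0 : ℝ) := by norm_num
  have hσ0 : σ ≠ 0 := by
    intro h; rw [h, zero_mul] at hσN; exact (abs_pos.2 hne).ne' hσN.symm |>.elim
  have hθ := isSmoothSpaceTimeOn_two hrate hcont hmild
  have hG := isSmoothSpaceTimeOn_weighted hrate hcont hmild σ
  have hmax := isLocalMax_weighted_of_hotPoint hne hhot hσN hy
  set G : ℝ → EuclideanSpace ℝ (Fin 3) → ℝ := fun t x => Real.sqrt (-t) * (σ * v t x 2) with hGdef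
  set B := fderiv ℝ (fderiv ℝ (uncurry G)) ((-1 : ℝ), y) with hB
  -- `B` is a symmetric negative semi-definite form on `ℝ × ℝ³`
  have hsym : ∀ u u', B u u' = B u' u := fun u u' => hG.isSymmSndFDerivAt isOpen_Iio h1 y u u'
  have hneg : ∀ d, B d d ≤ 0 := fun d => spacetimeHessian_weighted_nonpos_of_hotPoint hrate hcont hmild hne hhot hσN hy d
  -- the slice `G(−1,·)` is the signed component `σv₂(−1,·)`
  have hslice : G (-1) = fun x => σ * v (-1) x 2 := by
    funext x
    show Real.sqrt (-(-1 : ℝ)) * (σ * v (-1) x 2) = σ * v (-1) x 2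
    rw [neg_neg, Real.sqrt_one, one_mul]
  have hf2 : ContDiff ℝ 2 (fun x => σ * v (-1) x 2) := by
    rw [← hslice]; exact (hG.contDiff_slice h1).of_le (by exact WithTop.coe_le_coe.2 le_top)
  -- the `(x,x)` block of `B` is the slice Hessian, which vanishes on `(w,w)`
  have he : B ((0 : ℝ), w) ((0 : ℝ), w) = 0 := by
    rw [hB, ← fderiv_fderiv_slice_apply hG isOpen_Iio h1 y w w, hslice, ← fderiv_fderiv_eq_coord hf2 y w w]
    exact hnull
  -- hence `(0,w)` is in the kernel of `B`; read off the mixed entry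
  have h10 : B ((0 : ℝ), w) ((1 : ℝ), (0 : EuclideanSpace ℝ (Fin 3))) = 0 := bilin_apply_eq_zero_of_nonpos B hsym hneg he _
  rw [hB, ← hG.fderiv_deriv_slice_apply isOpen_Iio h1 y w] at h10
  -- `∂ₜG(−1,·) = σ∂ₜv₂(−1,·) − σv₂(−1,·)/2` as functions of `x`
  have hline : (fun x => deriv (fun s => G s x) (-1)) = fun x => σ * deriv (fun s => v s x 2) (-1) - (1 / 2 : ℝ) * (σ * v (-1) x 2) :=
    funext fun x => (hasDerivAt_weighted_timeLine hrate hcont hmild σ x).deriv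
  rw [hline] at h10
  -- differentiate at `y` in the direction `w`
  have hD1 : DifferentiableAt ℝ (fun x => deriv (fun s => v s x 2) (-1)) y :=
    (((hθ.isSmoothSpaceTimeOn_deriv isOpen_Iio).contDiff_slice h1).differentiable (by simp)) y
  have hD2 : DifferentiableAt ℝ (fun x => v (-1) x 2) y := ((hθ.contDiff_slice h1).differentiable (by simp)) y
  have hsum := ((hD1.hasFDerivAt.const_mul σ).fun_sub ((hD2.hasFDerivAt.const_mul σ).const_mul (1 / 2 : ℝ))).fderiv
  rw [hsum] at h10
  -- the gradient pin `σ·D(v₂(−1,·))(y) w = 0` (first order in `x` of the space–time maximum)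
  have hgrad : σ * fderiv ℝ (fun x => v (-1) x 2) y w = 0 := by
    have hfd0 : fderiv ℝ (uncurry G) ((-1 : ℝ), y) = 0 := hmax.fderiv_eq_zero
    have h := hG.fderiv_slice_apply_of_isOpen isOpen_Iio h1 y w
    rw [hfd0, hslice, (hD2.hasFDerivAt.const_mul σ).fderiv] at h
    simpa using h
  have hkey : σ * fderiv ℝ (fun x => deriv (fun s => v s x 2) (-1)) y w = 0 := by
    have h := h10
    simp only [sub_apply, smul_apply, smul_eq_mul] at h
    linarith [h, hgrad]
  exact (mul_eq_zero.1 hkey).resolve_left hσ0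

/-- **MIXED PIN FROM A NULL DIRECTION (form `∂ₜ(∇v₂)`):** under the same hypotheses, `∂ₜ(D(v(·))(y) w)₂ (−1) = 0` (exchange of `∂ₜ` and `∂_w`, Schwarz). -/
theorem deriv_fderiv_two_eq_zero_of_hessian_null (hrate : HasTypeITimeDecay C v) (hcont : ContinuousOn (uncurry v) (Iio (0 : ℝ) ×ˢ univ))
    (hmild : ∀ s t : ℝ, s < t → t < 0 → ∀ x, v t x = heatExtension (v s) (t - s) x - oseenDuhamel 1 s v v t x)
    (hne : v (-1) 0 2 ≠ 0) (hhot : ∀ t < 0, ∀ x, Real.sqrt (-t) * |v t x 2| ≤ |v (-1) 0 2|)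
    {σ : ℝ} (hσN : σ * v (-1) 0 2 = |v (-1) 0 2|) {y : EuclideanSpace ℝ (Fin 3)} (hy : v (-1) y 2 = v (-1) 0 2)
    {w : EuclideanSpace ℝ (Fin 3)} (hnull : fderiv ℝ (fderiv ℝ (fun x => σ * v (-1) x 2)) y w w = 0) :
    deriv (fun s => fderiv ℝ (v s) y w 2) (-1) = 0 := by
  have h1 : (-1 : ℝ) ∈ Iio (0 : ℝ) := by norm_num
  have hθ := isSmoothSpaceTimeOn_two hrate hcont hmild
  have hsm : IsSmoothSpaceTimeOn (Iio 0) v :=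
    (analyticOnNhd_uncurry hcont (bdd_of_hasTypeITimeDecay hrate) hmild).contDiffOn_of_completeSpace
  have hU : ∀ᶠ s in 𝓝 (-1 : ℝ), s < 0 := Iio_mem_nhds (by norm_num)
  -- componentwise: `D(v s)(y) w ₂ = D(v₂(s,·))(y) w` for `s < 0`
  have heq : (fun s => fderiv ℝ (v s) y w 2) =ᶠ[𝓝 (-1 : ℝ)] fun s => fderiv ℝ (fun x => v s x 2) y w := by
    filter_upwards [hU] with s hs
    exact (fderiv_apply_coord (v s) (((hsm.contDiff_slice hs).differentiable (by simp)) y) w 2).symm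
  rw [heq.deriv_eq]
  have h := hθ.deriv_fderiv_slice_eq_fderiv_deriv isOpen_Iio h1 y w
  change deriv (fun s => fderiv ℝ (fun x => v s x 2) y w) (-1) = fderiv ℝ (fun x => deriv (fun s => v s x 2) (-1)) y w at h
  rw [h]
  exact fderiv_timeDeriv_two_eq_zero_of_hessian_null hrate hcont hmild hne hhot hσN hy hnull

/-- **THE MIXED PIN OF THE FLAT SUB-CELL: `∇ₓ(∂ₜv₂)(−1,·)(y) = 0` at every flat hot point** (hypotheses of `…FlatRidgeJet.hessian_eq_zero_of_flatHotPoint`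
VERBATIM; memo T2B-g15 §16b).  With the vanishing 3-jet (`…FlatRidgeJet`, `…FlatRidgeCubic`) and NS this pins `∇(∂_z p)(−1,y) = 0` as well. -/
theorem fderiv_timeDeriv_two_eq_zero_of_flatHotPoint (hdec : HasTypeITimeDecay C v) (hcont : ContinuousOn (uncurry v) (Iio (0 : ℝ) ×ˢ univ))
    (hmild : ∀ s t : ℝ, s < t → t < 0 → ∀ x, v t x = heatExtension (v s) (t - s) x - oseenDuhamel 1 s v v t x)
    (hdiv : ∀ t < 0, VectorCalculus.IsDivFree (v t))
    (hTH : ∀ t < 0, ∀ x x' : EuclideanSpace ℝ (Fin 3), x 2 = x' 2 → ∀ b c : Fin 3, b ≠ 2 → c ≠ 2 →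
      fderiv ℝ (v t) x (EuclideanSpace.single 2 1) b * fderiv ℝ (v t) x' (EuclideanSpace.single c 1) 2 =
        fderiv ℝ (v t) x' (EuclideanSpace.single 2 1) c * fderiv ℝ (v t) x (EuclideanSpace.single b 1) 2)
    (hne : v (-1) 0 2 ≠ 0) (hhot : ∀ t < 0, ∀ x, Real.sqrt (-t) * |v t x 2| ≤ |v (-1) 0 2|)
    (hproper : ∀ y ∈ {y : EuclideanSpace ℝ (Fin 3) | y 2 = 0 ∧ v (-1) y 2 = v (-1) 0 2}, ∀ r : ℝ, 0 < r →
      ∃ y' : EuclideanSpace ℝ (Fin 3), y' 2 = 0 ∧ dist y' y < r ∧ v (-1) y' 2 ≠ v (-1) 0 2)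
    {σ : ℝ} (hσN : σ * v (-1) 0 2 = |v (-1) 0 2|)
    {y : EuclideanSpace ℝ (Fin 3)} (hy0 : y 2 = 0) (hy : v (-1) y 2 = v (-1) 0 2)
    (hflat : fderiv ℝ (fderiv ℝ (fun x => σ * v (-1) x 2)) y (EuclideanSpace.single 0 1) (EuclideanSpace.single 0 1) +
      fderiv ℝ (fderiv ℝ (fun x => σ * v (-1) x 2)) y (EuclideanSpace.single 1 1) (EuclideanSpace.single 1 1) = 0) :
    fderiv ℝ (fun x => deriv (fun s => v s x 2) (-1)) y = 0 := by
  ext w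
  rw [zero_apply]
  exact fderiv_timeDeriv_two_eq_zero_of_hessian_null hdec hcont hmild hne hhot hσN hy
    (hessian_eq_zero_of_flatHotPoint hdec hcont hmild hdiv hTH hne hhot hproper hσN hy0 hy hflat w w)

/-- Flat corollary, form `∂ₜ(∇v₂)`: `∂ₜ(D(v(·))(y) w)₂(−1) = 0` for every `w` at a flat hot point. -/
theorem deriv_fderiv_two_eq_zero_of_flatHotPoint (hdec : HasTypeITimeDecay C v) (hcont : ContinuousOn (uncurry v) (Iio (0 : ℝ) ×ˢ univ))
    (hmild : ∀ s t : ℝ, s < t → t < 0 → ∀ x, v t x = heatExtension (v s) (t - s) x - oseenDuhamel 1 s v v t x)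
    (hdiv : ∀ t < 0, VectorCalculus.IsDivFree (v t))
    (hTH : ∀ t < 0, ∀ x x' : EuclideanSpace ℝ (Fin 3), x 2 = x' 2 → ∀ b c : Fin 3, b ≠ 2 → c ≠ 2 →
      fderiv ℝ (v t) x (EuclideanSpace.single 2 1) b * fderiv ℝ (v t) x' (EuclideanSpace.single c 1) 2 =
        fderiv ℝ (v t) x' (EuclideanSpace.single 2 1) c * fderiv ℝ (v t) x (EuclideanSpace.single b 1) 2)
    (hne : v (-1) 0 2 ≠ 0) (hhot : ∀ t < 0, ∀ x, Real.sqrt (-t) * |v t x 2| ≤ |v (-1) 0 2|)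
    (hproper : ∀ y ∈ {y : EuclideanSpace ℝ (Fin 3) | y 2 = 0 ∧ v (-1) y 2 = v (-1) 0 2}, ∀ r : ℝ, 0 < r →
      ∃ y' : EuclideanSpace ℝ (Fin 3), y' 2 = 0 ∧ dist y' y < r ∧ v (-1) y' 2 ≠ v (-1) 0 2)
    {σ : ℝ} (hσN : σ * v (-1) 0 2 = |v (-1) 0 2|)
    {y : EuclideanSpace ℝ (Fin 3)} (hy0 : y 2 = 0) (hy : v (-1) y 2 = v (-1) 0 2)
    (hflat : fderiv ℝ (fderiv ℝ (fun x => σ * v (-1) x 2)) y (EuclideanSpace.single 0 1) (EuclideanSpace.single 0 1) +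
      fderiv ℝ (fderiv ℝ (fun x => σ * v (-1) x 2)) y (EuclideanSpace.single 1 1) (EuclideanSpace.single 1 1) = 0)
    (w : EuclideanSpace ℝ (Fin 3)) :
    deriv (fun s => fderiv ℝ (v s) y w 2) (-1) = 0 :=
  deriv_fderiv_two_eq_zero_of_hessian_null hdec hcont hmild hne hhot hσN hy
    (hessian_eq_zero_of_flatHotPoint hdec hcont hmild hdiv hTH hne hhot hproper hσN hy0 hy hflat w w)

end Summit.NavierStokesRegularity.NavierStokesRegularity.Theorems.PoloidalWindowDoorLrcModEntireTwistingTHFlatRidgeMixedPin
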